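import Literature.AlgebraicGeometry.Modules.FrameTransition
import Literature.AlgebraicGeometry.Modules.UnitCocycle
import Literature.AlgebraicGeometry.Deformation.SquareZeroExtensionObstruction
import HarnessLib

/-!
# Lifted transition matrices of a locally free module along a closed immersion, and their defect

Let `i : Z₀ ⟶ Z₁` be a closed immersion of schemes and `F` an `𝒪_{Z₀}`-module with frames
`e_a : 𝒪^{I_a} ≅ F|_{i⁻¹U_a}` over the preimages of opens `U_a ⊆ Z₁` (`FrameCover`). The
transition matrices `T_{ab} = T(e_a, e_b)` live over `i⁻¹(U_a ∩ U_b) ⊆ Z₀`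
(`Modules/FrameTransition.lean`). A **system of lifts** (`FrameCover.Lifts`) is a choice of matrices
`T̃_{ab}` over `U_a ∩ U_b ⊆ Z₁` with `i♯ T̃_{ab} = T_{ab}`; it exists as soon as the `U_a ∩ U_b` are
affine, since `i♯` is then surjective (`FrameCover.liftsOfIsAffineOpen`, Mathlib
`Scheme.Hom.app_surjective`). The **defect**

  `c_{abd} = T̃_{ab} T̃_{bd} - T̃_{ad}`  over `V ≤ U_a ∩ U_b ∩ U_d`  (`Lifts.defect`)

has entries killed by `i♯` (`map_defect`: `T_{ab} T_{bd} = T_{ad}`) and satisfies identically the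
twisted cocycle identity `T̃_{ab} c_{bdf} - c_{adf} + c_{abf} - c_{abd} T̃_{df} = 0`
(`defect_cocycle`). If `i` is a FIRST-ORDER THICKENING (`IsFirstOrderThickening`: `Ker(i♯)² = 0`),
products of sections killed by `i♯` vanish (`mul_eq_zero_of_app_eq_zero`), so two systems of lifts
`T̃' = T̃ + H` have defects differing by the coboundary-type expression
`c' - c = T̃_{ab} H_{bd} + H_{ab} T̃_{bd} - H_{ad}` (`defect_sub_defect`). This is the cocycle
calculus behind the obstruction to lifting a locally free sheaf across a first-order thickening
(Hartshorne, *Deformation Theory*, proof of Thm. 7.1 / FGA Explained Thm. 8.5.3 (b); Stacks 08L8),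
in matrix form; the class of `c` is studied in sibling files. Everything is proved; no named facts.

## References

* R. Hartshorne, *Deformation Theory*, GTM 257 (2010), §7, proof of Thm. 7.1. [Hartshorne2010]
* The Stacks Project, Tags 08KY, 08L8. [StacksProject]
-/

noncomputable section

open CategoryTheory AlgebraicGeometry Opposite TopologicalSpace Limits

namespace Literature.AlgebraicGeometry.Deformation

open Literature.AlgebraicGeometry.Modules Literature.AlgebraicGeometry.Motives

universe u

variable {Z₀ Z₁ : Scheme.{u}} (i : Z₀ ⟶ Z₁)

/-! ### Sections killed by `i♯` -/

section KerApp

/-- `i♯` commutes with restriction: `i♯(x|_V) = (i♯ x)|_{i⁻¹V}`. [folklore] -/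
lemma app_secRes {W V : Z₁.Opens} (h : V ≤ W) (x : Γ(Z₁, W)) :
    i.app V (secRes Z₁ h x) = secRes Z₀ ((Opens.map i.base).map (homOfLE h)).le (i.app W x) := by
  have e := ConcreteCategory.congr_hom (i.naturality (homOfLE h).op) x
  exact e

/-- The kernel of `i♯` is stable under restriction. [folklore] -/
lemma app_secRes_eq_zero {W V : Z₁.Opens} (h : V ≤ W) {x : Γ(Z₁, W)} (hx : i.app W x = 0) :
    i.app V (secRes Z₁ h x) = 0 := by
  rw [app_secRes, hx, map_zero]

/-- **On a first-order thickening, sections killed by `i♯` multiply to zero** (`Ker(i♯)² = 0`,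
checked on the affine opens, where `Ker(i♯)` is the ideal of the ideal sheaf `Ker i`, and glued by
germs). [cite: StacksProject, Tag 08KY] -/
theorem mul_eq_zero_of_app_eq_zero [IsFirstOrderThickening i] {W : Z₁.Opens} {x y : Γ(Z₁, W)}
    (hx : i.app W x = 0) (hy : i.app W y = 0) : x * y = 0 := by
  apply TopCat.Presheaf.section_ext Z₁.sheaf W
  intro p hp
  obtain ⟨V, hV, hpV, hVW⟩ := Opens.isBasis_iff_nbhd.mp Z₁.isBasis_affineOpens hp
  refine TopCat.Presheaf.germ_ext Z₁.presheaf V hpV (homOfLE hVW) (homOfLE hVW) ?_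
  change secRes Z₁ hVW (x * y) = secRes Z₁ hVW 0
  rw [map_mul, map_zero]
  have hxV : secRes Z₁ hVW x ∈ i.ker.ideal ⟨V, hV⟩ := by
    rw [Scheme.Hom.ker_apply]; exact app_secRes_eq_zero i hVW hx
  have hyV : secRes Z₁ hVW y ∈ i.ker.ideal ⟨V, hV⟩ := by
    rw [Scheme.Hom.ker_apply]; exact app_secRes_eq_zero i hVW hy
  have hmem : secRes Z₁ hVW x * secRes Z₁ hVW y ∈ (i.ker * i.ker).ideal ⟨V, hV⟩ := by
    rw [Scheme.IdealSheafData.ideal_mul]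
    exact Ideal.mul_mem_mul hxV hyV
  rw [IsFirstOrderThickening.ker_mul_ker_eq_bot, Scheme.IdealSheafData.ideal_bot] at hmem
  exact hmem

/-- Matrix form: on a first-order thickening, a product of matrices killed by `i♯` vanishes.
[cite: StacksProject, Tag 08KY] -/
theorem matrix_mul_eq_zero_of_map_eq_zero [IsFirstOrderThickening i] {W : Z₁.Opens}
    {m n o : Type*} [Fintype n] (M : Matrix m n Γ(Z₁, W)) (N : Matrix n o Γ(Z₁, W))
    (hM : M.map (i.app W).hom = 0) (hN : N.map (i.app W).hom = 0) : M * N = 0 := by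
  ext j l
  rw [Matrix.mul_apply, Matrix.zero_apply]
  refine Finset.sum_eq_zero fun k _ => mul_eq_zero_of_app_eq_zero i ?_ ?_
  · exact congrFun (congrFun hM j) k
  · exact congrFun (congrFun hN k) l

end KerApp

/-! ### Frames over preimages of opens of `Z₁`, and systems of lifts -/

variable (F : Z₀.Modules) (ι : Type u)

/-- **Frames of an `𝒪_{Z₀}`-module over the preimages of opens of `Z₁`**: opens `U_a ⊆ Z₁`,
finite index types `I_a` and trivialisations `e_a : 𝒪^{I_a} ≅ F|_{i⁻¹U_a}`. [folklore] -/
structure FrameCover where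
  /-- The open `U_a ⊆ Z₁`. -/
  U : ι → Z₁.Opens
  /-- The index type of the frame over `U_a`. -/
  I : ι → Type u
  /-- The index types are finite. -/
  [instFintype : ∀ a, Fintype (I a)]
  /-- The index types have decidable equality. -/
  [instDecidableEq : ∀ a, DecidableEq (I a)]
  /-- The frame `e_a : 𝒪^{I_a} ≅ F|_{i⁻¹U_a}`. -/
  e : ∀ a, SheafOfModules.free (I a) ≅ F.over (i ⁻¹ᵁ (U a))

attribute [instance] FrameCover.instFintype FrameCover.instDecidableEq

variable {i F ι}

namespace FrameCover

variable (C : FrameCover i F ι)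

/-- The inclusion `i⁻¹V ⟶ i⁻¹U_a` for `V ≤ U_a`. [folklore] -/
abbrev incl {V : Z₁.Opens} {a : ι} (h : V ≤ C.U a) : i ⁻¹ᵁ V ⟶ i ⁻¹ᵁ (C.U a) :=
  (Opens.map i.base).map (homOfLE h)

/-- **The transition matrix `T_{ab}` over `i⁻¹V`**, `V ≤ U_a ∩ U_b` an open of `Z₁`. [folklore] -/
def trans (a b : ι) (V : Z₁.Opens) (ha : V ≤ C.U a) (hb : V ≤ C.U b) :
    Matrix (C.I a) (C.I b) Γ(Z₀, i ⁻¹ᵁ V) :=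
  transition (C.e a) (C.e b) (C.incl ha) (C.incl hb)

/-- `T_{ab}` is compatible with restriction. [folklore] -/
lemma trans_map (a b : ι) {V V' : Z₁.Opens} (ha : V ≤ C.U a) (hb : V ≤ C.U b) (h : V' ≤ V) :
    (C.trans a b V ha hb).map (secRes Z₀ ((Opens.map i.base).map (homOfLE h)).le) =
      C.trans a b V' (h.trans ha) (h.trans hb) := by
  rw [trans, trans]
  exact transition_map (C.e a) (C.e b) (C.incl ha) (C.incl hb) ((Opens.map i.base).map (homOfLE h))

/-- Cocycle identity `T_{ab} T_{bd} = T_{ad}`. [folklore] -/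
lemma trans_mul (a b d : ι) (V : Z₁.Opens) (ha : V ≤ C.U a) (hb : V ≤ C.U b) (hd : V ≤ C.U d) :
    C.trans a b V ha hb * C.trans b d V hb hd = C.trans a d V ha hd :=
  transition_mul _ _ _ _ _ _

/-- `T_{aa} = 1`. [folklore] -/
lemma trans_self (a : ι) (V : Z₁.Opens) (ha : V ≤ C.U a) : C.trans a a V ha ha = 1 :=
  transition_self _ _

/-- **A system of lifts of the transition matrices to `Z₁`**: matrices `T̃_{ab}` over `U_a ∩ U_b`
with `i♯ T̃_{ab} = T_{ab}`. [cite: Hartshorne2010, §7 (proof of Thm. 7.1)] -/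
structure Lifts where
  /-- The lift `T̃_{ab}` over `U_a ∩ U_b`. -/
  T : ∀ a b, Matrix (C.I a) (C.I b) Γ(Z₁, C.U a ⊓ C.U b)
  /-- `i♯ T̃_{ab} = T_{ab}`. -/
  map_T : ∀ a b, (T a b).map (i.app (C.U a ⊓ C.U b)).hom = C.trans a b (C.U a ⊓ C.U b) inf_le_left inf_le_right

/-- **Lifts exist when the pairwise intersections `U_a ∩ U_b` are affine** (for a closed immersion
`i♯` is then surjective on sections, Mathlib `Scheme.Hom.app_surjective`); entrywise choice.
[cite: StacksProject, Tag 01QN] -/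
def liftsOfIsAffineOpen [IsClosedImmersion i] (hU : ∀ a b, IsAffineOpen (C.U a ⊓ C.U b)) : C.Lifts where
  T a b := Matrix.of fun j k =>
    Function.surjInv (i.app_surjective (C.U a ⊓ C.U b) (hU a b))
      (C.trans a b (C.U a ⊓ C.U b) inf_le_left inf_le_right j k)
  map_T a b := by
    ext j k
    exact Function.surjInv_eq (i.app_surjective (C.U a ⊓ C.U b) (hU a b)) _

/-- Systems of lifts exist when the pairwise intersections are affine. [folklore] -/
lemma nonempty_lifts [IsClosedImmersion i] (hU : ∀ a b, IsAffineOpen (C.U a ⊓ C.U b)) :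
    Nonempty C.Lifts :=
  ⟨C.liftsOfIsAffineOpen hU⟩

namespace Lifts

variable {C} (L : C.Lifts)

/-- The lift `T̃_{ab}` restricted to an open `V ≤ U_a ∩ U_b`. [folklore] -/
def TOn (a b : ι) (V : Z₁.Opens) (ha : V ≤ C.U a) (hb : V ≤ C.U b) :
    Matrix (C.I a) (C.I b) Γ(Z₁, V) :=
  (L.T a b).map (secRes Z₁ (le_inf ha hb))

/-- `T̃_{ab}|_V` is compatible with restriction. [folklore] -/
lemma TOn_map (a b : ι) {V V' : Z₁.Opens} (ha : V ≤ C.U a) (hb : V ≤ C.U b) (h : V' ≤ V) :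
    (L.TOn a b V ha hb).map (secRes Z₁ h) = L.TOn a b V' (h.trans ha) (h.trans hb) := by
  rw [TOn, TOn, Matrix.map_map]
  congr 1
  funext x
  exact secRes_secRes _ _ _

/-- **`i♯ (T̃_{ab}|_V) = T_{ab}|_{i⁻¹V}`.** [folklore] -/
lemma map_TOn (a b : ι) (V : Z₁.Opens) (ha : V ≤ C.U a) (hb : V ≤ C.U b) :
    (L.TOn a b V ha hb).map (i.app V).hom = C.trans a b V ha hb := by
  rw [TOn, Matrix.map_map]
  have h : ((i.app V).hom ∘ (secRes Z₁ (le_inf ha hb : V ≤ C.U a ⊓ C.U b))) =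
      (secRes Z₀ ((Opens.map i.base).map (homOfLE (le_inf ha hb : V ≤ C.U a ⊓ C.U b))).le) ∘
        (i.app (C.U a ⊓ C.U b)).hom := by
    funext x
    exact app_secRes i (le_inf ha hb) x
  rw [h, ← Matrix.map_map, L.map_T, C.trans_map a b inf_le_left inf_le_right (le_inf ha hb)]

/-- **The defect `c_{abd} = T̃_{ab} T̃_{bd} - T̃_{ad}`** of a system of lifts over
`V ≤ U_a ∩ U_b ∩ U_d`. [cite: Hartshorne2010, §7 (proof of Thm. 7.1)] -/
def defect (a b d : ι) (V : Z₁.Opens) (ha : V ≤ C.U a) (hb : V ≤ C.U b) (hd : V ≤ C.U d) :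
    Matrix (C.I a) (C.I d) Γ(Z₁, V) :=
  L.TOn a b V ha hb * L.TOn b d V hb hd - L.TOn a d V ha hd

/-- The defect is compatible with restriction. [folklore] -/
lemma defect_map (a b d : ι) {V V' : Z₁.Opens} (ha : V ≤ C.U a) (hb : V ≤ C.U b) (hd : V ≤ C.U d)
    (h : V' ≤ V) :
    (L.defect a b d V ha hb hd).map (secRes Z₁ h) =
      L.defect a b d V' (h.trans ha) (h.trans hb) (h.trans hd) := by
  rw [defect, defect, Matrix.map_sub _ (map_sub _), Matrix.map_mul, L.TOn_map, L.TOn_map, L.TOn_map]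

/-- **The defect is killed by `i♯`** (`T_{ab} T_{bd} = T_{ad}` on `Z₀`): its entries are sections of
the ideal `Ker(i♯)`. [cite: Hartshorne2010, §7 (proof of Thm. 7.1)] -/
theorem map_defect (a b d : ι) (V : Z₁.Opens) (ha : V ≤ C.U a) (hb : V ≤ C.U b) (hd : V ≤ C.U d) :
    (L.defect a b d V ha hb hd).map (i.app V).hom = 0 := by
  rw [defect, Matrix.map_sub _ (map_sub _), Matrix.map_mul, L.map_TOn, L.map_TOn, L.map_TOn, C.trans_mul,
    sub_self]

/-- Entries of the defect are killed by `i♯`. [folklore] -/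
lemma app_defect_apply (a b d : ι) (V : Z₁.Opens) (ha : V ≤ C.U a) (hb : V ≤ C.U b) (hd : V ≤ C.U d)
    (j : C.I a) (l : C.I d) : i.app V (L.defect a b d V ha hb hd j l) = 0 :=
  congrFun (congrFun (L.map_defect a b d V ha hb hd) j) l

/-- **The twisted cocycle identity of the defect**:
`T̃_{ab} c_{bdf} - c_{adf} + c_{abf} - c_{abd} T̃_{df} = 0` (an identity for any matrices).
[cite: Hartshorne2010, §7 (proof of Thm. 7.1)] -/
theorem defect_cocycle (a b d f : ι) (V : Z₁.Opens) (ha : V ≤ C.U a) (hb : V ≤ C.U b)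
    (hd : V ≤ C.U d) (hf : V ≤ C.U f) :
    L.TOn a b V ha hb * L.defect b d f V hb hd hf - L.defect a d f V ha hd hf +
      L.defect a b f V ha hb hf - L.defect a b d V ha hb hd * L.TOn d f V hd hf = 0 := by
  simp only [defect, Matrix.mul_sub, Matrix.sub_mul, Matrix.mul_assoc]
  abel

/-- `T̃_{aa}` is congruent to `1`: `i♯ T̃_{aa} = 1`. [folklore] -/
lemma map_TOn_self (a : ι) (V : Z₁.Opens) (ha : V ≤ C.U a) :
    (L.TOn a a V ha ha).map (i.app V).hom = 1 := by
  rw [L.map_TOn, C.trans_self]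

end Lifts

/-! ### Change of lifts on a first-order thickening -/

namespace Lifts

variable {C} (L L' : C.Lifts)

/-- The difference `H_{ab} = T̃'_{ab} - T̃_{ab}` of two systems of lifts, over `V ≤ U_a ∩ U_b`.
[folklore] -/
def diff (a b : ι) (V : Z₁.Opens) (ha : V ≤ C.U a) (hb : V ≤ C.U b) :
    Matrix (C.I a) (C.I b) Γ(Z₁, V) :=
  L'.TOn a b V ha hb - L.TOn a b V ha hb

/-- `T̃' = T̃ + H`. [folklore] -/
lemma TOn_eq_add_diff (a b : ι) (V : Z₁.Opens) (ha : V ≤ C.U a) (hb : V ≤ C.U b) :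
    L'.TOn a b V ha hb = L.TOn a b V ha hb + diff L L' a b V ha hb := by
  rw [diff, add_sub_cancel]

/-- The difference of two systems of lifts is killed by `i♯`. [folklore] -/
lemma map_diff (a b : ι) (V : Z₁.Opens) (ha : V ≤ C.U a) (hb : V ≤ C.U b) :
    (diff L L' a b V ha hb).map (i.app V).hom = 0 := by
  rw [diff, Matrix.map_sub _ (map_sub _), L.map_TOn, L'.map_TOn, sub_self]

/-- The difference is compatible with restriction. [folklore] -/
lemma diff_map (a b : ι) {V V' : Z₁.Opens} (ha : V ≤ C.U a) (hb : V ≤ C.U b) (h : V' ≤ V) :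
    (diff L L' a b V ha hb).map (secRes Z₁ h) = diff L L' a b V' (h.trans ha) (h.trans hb) := by
  rw [diff, diff, Matrix.map_sub _ (map_sub _), L.TOn_map, L'.TOn_map]

/-- **Change of lifts on a first-order thickening**: the defects of `T̃' = T̃ + H` and `T̃` differ by
`T̃_{ab} H_{bd} + H_{ab} T̃_{bd} - H_{ad}` (the term `H_{ab} H_{bd}` vanishes as `Ker(i♯)² = 0`).
[cite: Hartshorne2010, §7 (proof of Thm. 7.1)] -/
theorem defect_sub_defect [IsFirstOrderThickening i] (a b d : ι) (V : Z₁.Opens) (ha : V ≤ C.U a)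
    (hb : V ≤ C.U b) (hd : V ≤ C.U d) :
    L'.defect a b d V ha hb hd - L.defect a b d V ha hb hd =
      L.TOn a b V ha hb * diff L L' b d V hb hd + diff L L' a b V ha hb * L.TOn b d V hb hd -
        diff L L' a d V ha hd := by
  have hHH : diff L L' a b V ha hb * diff L L' b d V hb hd = 0 :=
    matrix_mul_eq_zero_of_map_eq_zero i _ _ (map_diff L L' a b V ha hb) (map_diff L L' b d V hb hd)
  simp only [defect, TOn_eq_add_diff L L', Matrix.add_mul, Matrix.mul_add, hHH, add_zero]
  abel

/-- **On a first-order thickening `T̃_{aa}` is an involution-free idempotent lift of `1`**: if the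
defect `c_{aaa}` vanishes then `T̃_{aa} = 1` (write `T̃_{aa} = 1 + N` with `i♯ N = 0`; then
`0 = c_{aaa} = (1 + N)² - (1 + N) = N` as `N² = 0`). [folklore] -/
theorem TOn_self_eq_one [IsFirstOrderThickening i] (a : ι) (V : Z₁.Opens) (ha : V ≤ C.U a)
    (h : L.defect a a a V ha ha ha = 0) : L.TOn a a V ha ha = 1 := by
  set N := L.TOn a a V ha ha - 1 with hN
  have hT : L.TOn a a V ha ha = 1 + N := by rw [hN, add_sub_cancel]
  have hmapN : N.map (i.app V).hom = 0 := by
    rw [hN, Matrix.map_sub _ (map_sub _), L.map_TOn_self, Matrix.map_one _ (map_zero _) (map_one _),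
      sub_self]
  have hNN : N * N = 0 := matrix_mul_eq_zero_of_map_eq_zero i _ _ hmapN hmapN
  have key : L.defect a a a V ha ha ha = N := by
    rw [defect, hT]
    simp only [Matrix.add_mul, Matrix.mul_add, Matrix.one_mul, Matrix.mul_one, hNN, add_zero]
    abel
  rw [hT, ← key, h, add_zero]

end Lifts

end FrameCover

end Literature.AlgebraicGeometry.Deformation

end
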